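import Summits.ResolutionOfSingularities.ResolutionOfSingularities.Theorems.WeightedInvariantContactCylinderGlobalMove
import Summits.ResolutionOfSingularities.ResolutionOfSingularities.Theorems.WeightedInvariantContactCylinderGenericSuccessor
import HarnessLib

/-!
# THE GLOBAL CYLINDER MOVE: consumer kit for the local/global dictionary `(ψ, 𝔫 ↦ 𝔫', g)` — coefficients, `t⁻¹`-primitivity,
# membership and order transport ((D2) HCURVE step of res-type-047; door `HypersurfaceCentreConstruction`,
# stmt-ResolutionOfSingularities-19897; KEY `stub_localWeightedDropEFT4S`, regime P3a)

Topic: `Summits/ResolutionOfSingularities/ResolutionOfSingularities/Theorems`. Helper for the door item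
`HypersurfaceCentreConstruction` (stmt-ResolutionOfSingularities-19897, route `WeightedInvariant`), line `local-engine` of
res-L1-w43-plan-1 (L W4.3).  No new objects.  The dictionary of `exists_ringHom_prime_ringEquiv_localMove'` (p538779):
`ψ : B = extReesAlgebra (weightedMonomialIdeal U W) → B' = extReesAlgebra I'` coefficientwise the localisation `A → A_𝔮`,
`𝔫 = ψ⁻¹ 𝔫'`, `g : B_𝔫 ≃+* B'_{𝔫'}` with `g (b/1) = (ψ b)/1`.  This file is what a consumer reads off it, stated over the
ABSTRACT data (so that both source types and both packages feed it):
(1) `coeff_eq_of_coe_eq_mapRingHom` — coefficients: `(ψ b)_n = (b_n)/1`;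
(2) `t⁻¹`-PRIMITIVITY: `tInv ∣ p ↔ ∀ m, p_{m-1} ∈ 𝒥_m` for the global move (`tInv_dvd_iff_forall_coeff_mem_weightedMonomialIdeal`,
res-type-005's coefficient criterion moved to the `extReesAlgebra` carrier by substitution), the same for `B'` with an abstract
presentation `I'` (`tInv_dvd_iff_forall_coeff_mem_of_presentation`), and the TRANSFER `tInv_dvd_map_iff` /
`not_tInv_dvd_map_of_forall` — `t⁻¹ ∤ G` persists under `ψ` exactly when the relevant coefficients of `G` stay outside
`𝒥_m A_𝔮` (res-D-brk-1 NOTE (N3) 2026-08-27T15:00:33Z: this is a pointwise condition at `𝔮`, automatic after a finite shrink);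
(3) along `g`: `mem_maximalIdeal_pow_iff_of_dictionary` (`G/1 ∈ 𝔪_𝔫ⁿ ↔ (ψ G)/1 ∈ 𝔪_{𝔫'}ⁿ`), `iota_eq_of_dictionary` (any (c6) `ι`);
(4) elements: `mem_iff_map_mem_of_comap_eq` (`b ∈ 𝔫 ↔ ψ b ∈ 𝔫'`), `map_algebraMap_le_iff_of_dictionary` (base primes
`P B ≤ 𝔫 ↔ (P A_𝔮) B' ≤ 𝔫'`), the chart generators `ψ (uᵢ t^{wᵢ}) = (uᵢ/1) t^{wᵢ}` (`coe_map_generator`, for any member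
`X` of `B` lying over `uᵢ T^{wᵢ}`) and `not_vertexIdeal_le_of_generator_not_mem` (`uᵢ t^{wᵢ} ∉ 𝔫 ⇒ vertex ⊄ 𝔫'`).  Def-free.

[OURS · L1 W4.3 · (o28)/(D2)]  Replaces the role of NO printed item; NOT a statement of the manuscript
[claim: Hironaka2017, status: under-review]. AI work, weaker than expert review.  Pure commutative algebra; no named facts.

## References

* J. Włodarczyk, *Functorial resolution except for toroidal locus. Toroidal compactification*, Def. 5.1.1. [Wlodarczyk2022]
* res-type-047 2026-08-27T14:50:40Z (HCURVE consumer); res-type-005 `tInv_dvd_iff_forall_coeff_mem` (p532378 lineage).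
-/

noncomputable section

open IsLocalRing Literature.AlgebraicGeometry.Resolution LaurentPolynomial
open Summit.ResolutionOfSingularities.ResolutionOfSingularities.Cruxes.HypersurfaceCentreConstruction.LocalEngine

set_option linter.dupNamespace false -- mandated namespace of this single-conjunct summit

namespace Summit.ResolutionOfSingularities.ResolutionOfSingularities.Theorems

namespace ContactCylinder

/-! ## (1) Coefficients of a coefficientwise map -/

/-- If `ψ` is coefficientwise `φ` on Laurent polynomials then `(ψ b)_n = φ (b_n)`. [folklore] -/
theorem coeff_eq_of_coe_eq_mapRingHom {A A' : Type} [CommRing A] [CommRing A'] (φ : A →+* A')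
    {S : Subalgebra A A[T;T⁻¹]} {S' : Subalgebra A' A'[T;T⁻¹]} (ψ : S →+* S')
    (hψ : ∀ b : S, ((ψ b : S') : A'[T;T⁻¹]) = AddMonoidAlgebra.mapRingHom ℤ φ (b : A[T;T⁻¹])) (b : S) (n : ℤ) :
    ((ψ b : S') : A'[T;T⁻¹]).coeff n = φ ((b : A[T;T⁻¹]).coeff n) := by
  rw [hψ b, AddMonoidAlgebra.coeff_mapRingHom]

/-! ## (2) `t⁻¹`-primitivity is a coefficient condition, on both sides, and its transfer -/

/-- res-type-005's coefficient criterion on any subalgebra EQUAL to `⊕ 𝒥ₙ tⁿ`, the element `t⁻¹` given as a member over `T⁻¹`: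
`t ∣ p ↔ ∀ m, p_{m-1} ∈ 𝒥_m`. [cite: Wlodarczyk2022, Def. 5.1.1] -/
theorem tInv_dvd_iff_forall_coeff_mem_of_eq {A : Type} [CommRing A] (F : IdealFiltration A) (S : Subalgebra A A[T;T⁻¹])
    (hS : S = F.extendedRees) (t : S) (ht : (t : A[T;T⁻¹]) = T (-1)) (p : S) :
    t ∣ p ↔ ∀ m : ℕ, (p : A[T;T⁻¹]).coeff ((m : ℤ) - 1) ∈ F.ideal m := by
  subst hS
  have htt : t = ⟨T (-1), F.T_neg_one_mem_extendedRees⟩ := Subtype.ext ht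
  subst htt
  exact tInv_dvd_iff_forall_coeff_mem F p

/-- **`t⁻¹`-primitivity in the global move is a coefficient condition**: for `p ∈ B = extReesAlgebra (weightedMonomialIdeal U W)`,
`tInv ∣ p ↔ ∀ m, p_{m-1} ∈ 𝒥_m(U, W)`. [cite: Wlodarczyk2022, Def. 5.1.1] -/
theorem tInv_dvd_iff_forall_coeff_mem_weightedMonomialIdeal {A : Type} [CommRing A] {m : ℕ} (U : Fin m → A) (W : Fin m → ℕ)
    (p : extReesAlgebra (weightedMonomialIdeal U W)) :
    extReesAlgebra.tInv (weightedMonomialIdeal U W) ∣ p ↔ ∀ n : ℕ, (p : A[T;T⁻¹]).coeff ((n : ℤ) - 1) ∈ weightedMonomialIdeal U W n := by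
  rw [tInv_dvd_iff_forall_coeff_mem_of_eq (weightedFiltration U W) (extReesAlgebra (weightedMonomialIdeal U W))
    (extReesAlgebra_weightedMonomialIdeal_eq_extendedRees U W) (extReesAlgebra.tInv _) (extReesAlgebra.coe_tInv _) p]
  refine forall_congr' fun n => ?_
  rw [weightedFiltration_ideal_eq]

/-- **The same in the local move with an ABSTRACT presentation** `I'` of the pieces (`I' 0 = ⊤`, antitone, multiplicative — e.g.
`I' n = 𝒥_n A_𝔮`): `tInv I' ∣ p ↔ ∀ m, p_{m-1} ∈ I' m`. [cite: Wlodarczyk2022, Def. 5.1.1] -/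
theorem tInv_dvd_iff_forall_coeff_mem_of_presentation {A' : Type} [CommRing A'] (F' : IdealFiltration A')
    (p : extReesAlgebra F'.ideal) :
    extReesAlgebra.tInv F'.ideal ∣ p ↔ ∀ n : ℕ, (p : A'[T;T⁻¹]).coeff ((n : ℤ) - 1) ∈ F'.ideal n :=
  tInv_dvd_iff_forall_coeff_mem_of_eq F' (extReesAlgebra F'.ideal) F'.extReesAlgebra_ideal_eq_extendedRees
    (extReesAlgebra.tInv _) (extReesAlgebra.coe_tInv _) p

section Dictionary

variable {A : Type} [CommRing A] {m : ℕ} (U : Fin m → A) (W : Fin m → ℕ) (𝔮 : Ideal A) [𝔮.IsPrime]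
  {I' : ℕ → Ideal (Localization.AtPrime 𝔮)}
  (hI' : ∀ n, I' n = (weightedMonomialIdeal U W n).map (algebraMap A (Localization.AtPrime 𝔮)))
  (ψ : extReesAlgebra (weightedMonomialIdeal U W) →+* extReesAlgebra I')
  (hψ : ∀ b : extReesAlgebra (weightedMonomialIdeal U W), ((ψ b : extReesAlgebra I') : (Localization.AtPrime 𝔮)[T;T⁻¹]) =
    AddMonoidAlgebra.mapRingHom ℤ (algebraMap A (Localization.AtPrime 𝔮)) (b : A[T;T⁻¹]))

include hI' hψ in
/-- **`t⁻¹`-primitivity in the local move, through the dictionary**: `tInv I' ∣ ψ G ↔ ∀ m, (G_{m-1})/1 ∈ I' m`.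
[cite: Wlodarczyk2022, Def. 5.1.1] -/
theorem tInv_dvd_map_iff (G : extReesAlgebra (weightedMonomialIdeal U W)) :
    extReesAlgebra.tInv I' ∣ ψ G ↔
      ∀ n : ℕ, algebraMap A (Localization.AtPrime 𝔮) ((G : A[T;T⁻¹]).coeff ((n : ℤ) - 1)) ∈ I' n := by
  -- the presentation `I'` IS an ideal filtration (`I' 0 = ⊤`, antitone, multiplicative)
  let F' : IdealFiltration (Localization.AtPrime 𝔮) :=
    { ideal := I'
      ideal_zero := by rw [hI' 0, weightedMonomialIdeal_zero, Ideal.map_top]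
      antitone := fun a b h => by rw [hI' a, hI' b]; exact Ideal.map_mono (weightedMonomialIdeal_antitone U W h)
      mul_le := fun a b => by
        rw [hI' a, hI' b, hI' (a + b), ← Ideal.map_mul, ← weightedFiltration_ideal_eq]
        exact Ideal.map_mono ((weightedFiltration U W).mul_le a b) }
  have h := tInv_dvd_iff_forall_coeff_mem_of_presentation F' (ψ G)
  refine h.trans (forall_congr' fun n => ?_)
  rw [coeff_eq_of_coe_eq_mapRingHom (algebraMap A (Localization.AtPrime 𝔮)) ψ hψ G]

include hI' hψ in
/-- **TRANSFER OF `t⁻¹`-PRIMITIVITY** (NOTE (N3)): if `t⁻¹ ∤ G` in the global move and the coefficients of `G` that lie in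
`𝒥_m A_𝔮` already lie in `𝒥_m` (a pointwise contractedness condition at `𝔮` for THIS `G` — automatic after removing the finitely
many points of the curve where the weighted order of `f` jumps), then `t⁻¹ ∤ ψ G` in the local move. [folklore] -/
theorem not_tInv_dvd_map_of_forall (G : extReesAlgebra (weightedMonomialIdeal U W))
    (hG : ¬ extReesAlgebra.tInv (weightedMonomialIdeal U W) ∣ G)
    (hcontr : ∀ n : ℕ, algebraMap A (Localization.AtPrime 𝔮) ((G : A[T;T⁻¹]).coeff ((n : ℤ) - 1)) ∈ I' n →
      (G : A[T;T⁻¹]).coeff ((n : ℤ) - 1) ∈ weightedMonomialIdeal U W n) :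
    ¬ extReesAlgebra.tInv I' ∣ ψ G := by
  rw [tInv_dvd_map_iff U W 𝔮 hI' ψ hψ]
  rw [tInv_dvd_iff_forall_coeff_mem_weightedMonomialIdeal] at hG
  exact fun h => hG fun n => hcontr n (h n)

/-- Conversely `t⁻¹ ∣ G ⇒ t⁻¹ ∣ ψ G` (a ring map preserves divisibility; recorded with the coefficient reading). [folklore] -/
theorem tInv_dvd_map_of_dvd (hψt : ψ (extReesAlgebra.tInv (weightedMonomialIdeal U W)) = extReesAlgebra.tInv I')
    (G : extReesAlgebra (weightedMonomialIdeal U W)) (hG : extReesAlgebra.tInv (weightedMonomialIdeal U W) ∣ G) :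
    extReesAlgebra.tInv I' ∣ ψ G := by
  rw [← hψt]
  exact map_dvd ψ hG

/-! ## (4) Elements under the dictionary: membership, base primes, chart generators, the vertex -/

/-- `b ∈ 𝔫 ↔ ψ b ∈ 𝔫'` when `𝔫 = ψ⁻¹ 𝔫'`. [folklore] -/
theorem mem_iff_map_mem_of_comap_eq {𝔫 : Ideal (extReesAlgebra (weightedMonomialIdeal U W))} {𝔫' : Ideal (extReesAlgebra I')}
    (hcomap : 𝔫'.comap ψ = 𝔫) (b : extReesAlgebra (weightedMonomialIdeal U W)) : b ∈ 𝔫 ↔ ψ b ∈ 𝔫' := by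
  rw [← hcomap, Ideal.mem_comap]

/-- **Base primes**: `P · B ≤ 𝔫 ↔ (P A_𝔮) · B' ≤ 𝔫'` for every ideal `P` of `A` (the structure maps commute with `ψ`). [folklore] -/
theorem map_algebraMap_le_iff_of_dictionary
    (hψa : ∀ a : A, ψ (algebraMap A (extReesAlgebra (weightedMonomialIdeal U W)) a) =
      algebraMap (Localization.AtPrime 𝔮) (extReesAlgebra I') (algebraMap A (Localization.AtPrime 𝔮) a))
    {𝔫 : Ideal (extReesAlgebra (weightedMonomialIdeal U W))} {𝔫' : Ideal (extReesAlgebra I')} [𝔫'.IsPrime]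
    (hcomap : 𝔫'.comap ψ = 𝔫) (P : Ideal A) :
    P.map (algebraMap A (extReesAlgebra (weightedMonomialIdeal U W))) ≤ 𝔫 ↔
      (P.map (algebraMap A (Localization.AtPrime 𝔮))).map (algebraMap (Localization.AtPrime 𝔮) (extReesAlgebra I')) ≤ 𝔫' := by
  rw [Ideal.map_map, Ideal.map_le_iff_le_comap, Ideal.map_le_iff_le_comap]
  refine forall_congr' fun a => imp_congr_right fun _ => ?_
  rw [Ideal.mem_comap, Ideal.mem_comap, RingHom.comp_apply, ← hψa, ← hcomap, Ideal.mem_comap]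

include hψ in
/-- **`ψ` maps chart generators to chart generators**: for `X = uᵢ t^{wᵢ} ∈ B`, `ψ X = (uᵢ/1) t^{wᵢ}`. [folklore] -/
theorem coe_map_generator {i : Fin m} (X : extReesAlgebra (weightedMonomialIdeal U W)) (hX : (X : A[T;T⁻¹]) = C (U i) * T (W i : ℤ)) :
    ((ψ X : extReesAlgebra I') : (Localization.AtPrime 𝔮)[T;T⁻¹]) = C (algebraMap A (Localization.AtPrime 𝔮) (U i)) * T (W i : ℤ) := by
  rw [hψ, hX, ← single_eq_C_mul_T, AddMonoidAlgebra.mapRingHom_single, single_eq_C_mul_T]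

include hI' hψ in
/-- The image of a chart generator `X = uᵢ t^{wᵢ}` of positive weight lies in the vertex ideal of the local move.
[cite: Wlodarczyk2022, Def. 2.3.5] -/
theorem map_generator_mem_vertexIdeal {i : Fin m} (hi : 0 < W i) (X : extReesAlgebra (weightedMonomialIdeal U W))
    (hX : (X : A[T;T⁻¹]) = C (U i) * T (W i : ℤ)) : ψ X ∈ extReesAlgebra.vertexIdeal I' := by
  refine Ideal.subset_span ⟨W i, hi, algebraMap A (Localization.AtPrime 𝔮) (U i), ?_, coe_map_generator U W 𝔮 ψ hψ X hX⟩
  rw [hI']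
  exact Ideal.mem_map_of_mem _ (mem_weightedMonomialIdeal_self U W i)

include hI' hψ in
/-- **The `X`-chart condition kills the vertex**: if the chart generator `uᵢ t^{wᵢ}` (positive weight) is NOT in `𝔫 = ψ⁻¹ 𝔫'`,
then `vertexIdeal I' ⊄ 𝔫'` — the «off the vertex» binder of the (drop) clauses at `𝔫'`. [folklore] -/
theorem not_vertexIdeal_le_of_generator_not_mem {𝔫 : Ideal (extReesAlgebra (weightedMonomialIdeal U W))}
    {𝔫' : Ideal (extReesAlgebra I')} (hcomap : 𝔫'.comap ψ = 𝔫) {i : Fin m} (hi : 0 < W i)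
    (X : extReesAlgebra (weightedMonomialIdeal U W)) (hX : (X : A[T;T⁻¹]) = C (U i) * T (W i : ℤ)) (hXn : X ∉ 𝔫) :
    ¬ extReesAlgebra.vertexIdeal I' ≤ 𝔫' := fun hle =>
  hXn ((mem_iff_map_mem_of_comap_eq U W 𝔮 ψ hcomap _).mpr (hle (map_generator_mem_vertexIdeal U W 𝔮 hI' ψ hψ hi X hX)))

/-- The chart generators exist in `B`: `uᵢ t^{wᵢ} ∈ extReesAlgebra (weightedMonomialIdeal U W)` for `wᵢ > 0`. [cite: Wlodarczyk2022, Def. 2.3.5] -/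
theorem C_mul_T_mem_extReesAlgebra_weightedMonomialIdeal {i : Fin m} (hi : 0 < W i) :
    C (U i) * T (W i : ℤ) ∈ extReesAlgebra (weightedMonomialIdeal U W) :=
  extReesAlgebra.C_mul_T_mem _ hi (mem_weightedMonomialIdeal_self U W i)

end Dictionary

/-! ## (3) Along the isomorphism of local rings `g : B_𝔫 ≃ B'_{𝔫'}` -/

section AlongG

variable {B B' : Type} [CommRing B] [CommRing B'] (ψ : B →+* B') (𝔫 : Ideal B) [𝔫.IsPrime] (𝔫' : Ideal B') [𝔫'.IsPrime]
  (g : Localization.AtPrime 𝔫 ≃+* Localization.AtPrime 𝔫')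
  (hg : ∀ b : B, g (algebraMap B (Localization.AtPrime 𝔫) b) = algebraMap B' (Localization.AtPrime 𝔫') (ψ b))

include hg in
/-- **Order transport**: `G/1 ∈ 𝔪_{B_𝔫}ⁿ ↔ (ψ G)/1 ∈ 𝔪_{B'_{𝔫'}}ⁿ`. [folklore] -/
theorem mem_maximalIdeal_pow_iff_of_dictionary (G : B) (n : ℕ) :
    algebraMap B (Localization.AtPrime 𝔫) G ∈ maximalIdeal (Localization.AtPrime 𝔫) ^ n ↔
      algebraMap B' (Localization.AtPrime 𝔫') (ψ G) ∈ maximalIdeal (Localization.AtPrime 𝔫') ^ n := by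
  constructor
  · intro h
    rw [← hg]
    exact mem_maximalIdeal_pow_of_ringEquiv_atPrime 𝔫 𝔫' g h
  · intro h
    have h' := mem_maximalIdeal_pow_of_ringEquiv_atPrime 𝔫' 𝔫 g.symm h
    rwa [← hg, RingEquiv.symm_apply_apply] at h'

include hg in
/-- **(c6)-transport of any iso-invariant `ι`**: `ι (B'_{𝔫'}) ((ψ G)/1) = ι (B_𝔫) (G/1)`. [folklore] -/
theorem iota_eq_of_dictionary {ι : (R : Type) → [CommRing R] → R → Ordinal.{0}} (hι : IotaIsoInvariant ι) (G : B) :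
    ι (Localization.AtPrime 𝔫') (algebraMap B' (Localization.AtPrime 𝔫') (ψ G)) =
      ι (Localization.AtPrime 𝔫) (algebraMap B (Localization.AtPrime 𝔫) G) := by
  rw [← hg]
  exact iota_ringEquiv_atPrime 𝔫 𝔫' hι g _

include hg in
/-- **Order transport, `adicOrder` form**: `ord_{B'_{𝔫'}}((ψ G)/1) = ord_{B_𝔫}(G/1)`. [folklore] -/
theorem adicOrder_eq_of_dictionary (G : B) :
    adicOrder (algebraMap B' (Localization.AtPrime 𝔫') (ψ G)) = adicOrder (algebraMap B (Localization.AtPrime 𝔫) G) := by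
  refine le_antisymm ?_ ?_
  · refine ENat.forall_natCast_le_iff_le.mp fun n hn => ?_
    rw [le_adicOrder_iff] at hn ⊢
    exact (mem_maximalIdeal_pow_iff_of_dictionary ψ 𝔫 𝔫' g hg G n).mpr hn
  · refine ENat.forall_natCast_le_iff_le.mp fun n hn => ?_
    rw [le_adicOrder_iff] at hn ⊢
    exact (mem_maximalIdeal_pow_iff_of_dictionary ψ 𝔫 𝔫' g hg G n).mp hn

include hg in
/-- Transport of the transform equation: `f = t′ᵃ G` in `B` gives `(f/1) = (t′/1)ᵃ (G/1)` on both sides compatibly with `g`.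
[folklore] -/
theorem map_eq_pow_mul_of_dictionary {t G f : B} {a : ℕ} (hf : f = t ^ a * G) :
    g (algebraMap B (Localization.AtPrime 𝔫) f) =
      algebraMap B' (Localization.AtPrime 𝔫') (ψ t) ^ a * algebraMap B' (Localization.AtPrime 𝔫') (ψ G) := by
  rw [hg, hf, map_mul, map_pow, map_mul, map_pow]

end AlongG

/-! ## rev 2: the `t⁻¹`-adic factorisation `f = t⁻ᵃ G`, `t⁻¹ ∤ G`, is UNIQUE in a domain (global `a` = local `a` under `ψ`) -/

/-- **Uniqueness of the transform**: in a domain, `tᵃ g = tᵃ′ g′` with `t ∤ g`, `t ∤ g′`, `t ≠ 0` forces `a = a′` and `g = g′` — so the global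
factorisation `ψ f = t⁻ᵃ ψ G` (with `t⁻¹ ∤ ψ G` by `not_tInv_dvd_map_of_forall`) IS the local one, and local statements quantified over
«every `f = t⁻ᵃ′ g′`, `t⁻¹ ∤ g′`» apply to `(a, ψ G)`. [folklore] -/
theorem eq_of_pow_mul_eq_pow_mul {B : Type} [CommRing B] [IsDomain B] {t : B} (ht : t ≠ 0) {a a' : ℕ} {g g' : B}
    (h : t ^ a * g = t ^ a' * g') (hg : ¬ t ∣ g) (hg' : ¬ t ∣ g') : a = a' ∧ g = g' := by
  -- symmetric core: `a ≤ a′` forces `a = a′`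
  have key : ∀ {a a' : ℕ} {g g' : B}, t ^ a * g = t ^ a' * g' → ¬ t ∣ g → a ≤ a' → a = a' ∧ g = g' := by
    intro a a' g g' h hg hle
    obtain ⟨d, rfl⟩ := Nat.exists_eq_add_of_le hle
    rw [pow_add, mul_assoc] at h
    have hg_eq : g = t ^ d * g' := mul_left_cancel₀ (pow_ne_zero a ht) h
    rcases Nat.eq_zero_or_pos d with rfl | hd
    · rw [pow_zero, one_mul] at hg_eq
      exact ⟨(Nat.add_zero a).symm, hg_eq⟩
    · exact absurd ⟨t ^ (d - 1) * g', by rw [hg_eq, ← mul_assoc, ← pow_succ', Nat.sub_add_cancel hd]⟩ hg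
  rcases le_total a a' with hle | hle
  · exact key h hg hle
  · obtain ⟨h1, h2⟩ := key h.symm hg' hle
    exact ⟨h1.symm, h2.symm⟩

/-- `t⁻¹ ≠ 0` in every extended Rees algebra over a nontrivial ring. [folklore] -/
theorem tInv_ne_zero {A : Type} [CommRing A] [Nontrivial A] (I : ℕ → Ideal A) : extReesAlgebra.tInv I ≠ 0 := by
  intro h
  have h' := congrArg (fun b : extReesAlgebra I => (b : A[T;T⁻¹])) h
  simp only [extReesAlgebra.coe_tInv, ZeroMemClass.coe_zero] at h'
  exact (isUnit_T (-1 : ℤ) (R := A)).ne_zero h'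

/-- **Global `a` = local `a`**: the transform factorisations in the local move are unique (`extReesAlgebra I′` over a domain is a domain).
[folklore] -/
theorem transform_unique {A' : Type} [CommRing A'] [IsDomain A'] (I' : ℕ → Ideal A') {a a' : ℕ} {g g' : extReesAlgebra I'}
    (h : extReesAlgebra.tInv I' ^ a * g = extReesAlgebra.tInv I' ^ a' * g') (hg : ¬ extReesAlgebra.tInv I' ∣ g)
    (hg' : ¬ extReesAlgebra.tInv I' ∣ g') : a = a' ∧ g = g' :=
  eq_of_pow_mul_eq_pow_mul (tInv_ne_zero I') h hg hg'

end ContactCylinder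

end Summit.ResolutionOfSingularities.ResolutionOfSingularities.Theorems

end
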